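import Literature.Algebra.Polynomial.CasasAlvero.PrimePower
import Mathlib.Algebra.Polynomial.FieldDivision
import Mathlib.FieldTheory.IsAlgClosed.AlgebraicClosure
import Mathlib.FieldTheory.Perfect
import HarnessLib

/-!
# Casas-Alvero: descent along field embeddings; the characteristic-`p` theorems over ALL fields

`PrimePower.lean` proves the characteristic-`p` half of [GvBLSW 2007] (H.-C. Graf von Bothmer, O. Labs,
J. Schicho, C. van de Woestijne, *The Casas-Alvero conjecture for infinitely many degrees*, J. Algebra 316
(2007) 224–230, arXiv:math/0605090) over PERFECT rings of characteristic `p`: a monic Casas-Alvero polynomial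
of degree `p^k` or `2 p^k` is `(X - a)^d` (`holdsInDegree_prime_pow`, `holdsInDegree_two_mul_prime_pow`).

This file removes the perfectness hypothesis for fields:

* `HoldsInDegree.descend` — **descent**: for a field embedding `φ : K →+* L`, if the Casas-Alvero statement
  holds in degree `d` over `L` then it holds in degree `d` over `K`.  (A Casas-Alvero polynomial over `K` stays
  Casas-Alvero over `L` — `IsCasasAlvero.map` — so it is `(X - b)^d` over `L`, and `b` is the root it already
  has in `K`.)
* `holdsInDegree_prime_pow_field`, `holdsInDegree_two_mul_prime_pow_field` — over EVERY field `K` of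
  characteristic `p` (e.g. `𝔽_p(t)`), a monic Casas-Alvero polynomial of degree `p^k`, resp. `2 p^k`, is
  `(X - a)^d` with `a ∈ K`: descend from the algebraic closure of `K`, which is perfect.

The converse direction (ascent `HoldsInDegree K d → HoldsInDegree L d`) is false in general and is not claimed:
`HoldsInDegree K d` only speaks about polynomials whose Casas-Alvero witnesses lie in `K`.
-/

noncomputable section

open Polynomial

namespace Literature.Algebra.Polynomial.CasasAlvero

/-- Hasse derivatives commute with extension of scalars. [folklore] -/
theorem hasseDeriv_map {R S : Type*} [CommRing R] [CommRing S] (φ : R →+* S) (i : ℕ) (f : R[X]) :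
    hasseDeriv i (f.map φ) = (hasseDeriv i f).map φ := by
  ext n
  simp only [hasseDeriv_coeff, coeff_map, map_mul, map_natCast]

variable {K L : Type*} [Field K] [Field L]

/-- A shared root survives extension of scalars along a ring homomorphism. [folklore] -/
theorem SharesRoot.map {R S : Type*} [CommRing R] [CommRing S] (φ : R →+* S) {f g : R[X]}
    (h : SharesRoot f g) : SharesRoot (f.map φ) (g.map φ) := by
  obtain ⟨θ, hf, hg⟩ := h
  exact ⟨φ θ, by rw [eval_map, eval₂_hom, hf, map_zero], by rw [eval_map, eval₂_hom, hg, map_zero]⟩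

/-- The Casas-Alvero property is preserved by extension of scalars along a field embedding (the degree is
preserved because `K` is a field). [folklore] -/
theorem IsCasasAlvero.map (φ : K →+* L) {f : K[X]} (h : IsCasasAlvero f) : IsCasasAlvero (f.map φ) := by
  intro i hi0 hi
  rw [natDegree_map] at hi
  rw [hasseDeriv_map]
  exact (h i hi0 hi).map φ

/-- **Descent.** If the Casas-Alvero statement holds in degree `d` over a field `L`, it holds in degree `d` over
every field `K` embedding into `L`. [folklore] -/
theorem HoldsInDegree.descend (φ : K →+* L) {d : ℕ} (h : HoldsInDegree L d) : HoldsInDegree K d := by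
  intro f hf hd hca
  rcases Nat.lt_or_ge d 2 with hd2 | hd2
  · interval_cases d
    · exact ⟨0, by rw [pow_zero]; exact (Monic.natDegree_eq_zero hf).mp hd⟩
    · refine ⟨-f.coeff 0, ?_⟩
      rw [pow_one, map_neg, sub_neg_eq_add]
      exact Monic.eq_X_add_C hf hd
  · obtain ⟨θ, hθ, -⟩ := hca 1 one_pos (by omega)
    obtain ⟨b, hb⟩ := h (f.map φ) (hf.map φ) (by rw [natDegree_map, hd]) (hca.map φ)
    have hθb : φ θ = b := by
      have h0 := congrArg (eval (φ θ)) hb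
      rw [eval_map, eval₂_hom, hθ, map_zero, eval_pow, eval_sub, eval_X, eval_C] at h0
      exact sub_eq_zero.mp ((pow_eq_zero_iff (by omega)).mp h0.symm)
    refine ⟨θ, map_injective φ φ.injective ?_⟩
    rw [Polynomial.map_pow, Polynomial.map_sub, map_X, map_C, hθb]
    exact hb

section CharP

variable (K) (p : ℕ) [Fact p.Prime] [CharP K p]

/-- **GvBLSW Prop. 5 over every field of characteristic `p`**: a monic Casas-Alvero polynomial of degree `p^k`
over a field `K` of characteristic `p` (perfect or not) is `(X - a)^(p^k)` with `a ∈ K`.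
[cite: GrafVonBothmerEtAl2007, Prop. 5] -/
theorem holdsInDegree_prime_pow_field (k : ℕ) : HoldsInDegree K (p ^ k) :=
  HoldsInDegree.descend (algebraMap K (AlgebraicClosure K)) (holdsInDegree_prime_pow p k)

/-- **GvBLSW Prop. 6 (`n = 2`) over every field of characteristic `p`**: a monic Casas-Alvero polynomial of degree
`2 p^k` over a field `K` of characteristic `p` (perfect or not) is `(X - a)^(2 p^k)` with `a ∈ K`.
[cite: GrafVonBothmerEtAl2007, Prop. 6] -/
theorem holdsInDegree_two_mul_prime_pow_field (k : ℕ) : HoldsInDegree K (2 * p ^ k) :=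
  HoldsInDegree.descend (algebraMap K (AlgebraicClosure K)) (holdsInDegree_two_mul_prime_pow p k)

end CharP


end Literature.Algebra.Polynomial.CasasAlvero
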